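import Literature.NumberTheory.EllipticCurves.ManinConstantSemistablePrimewise
import Literature.NumberTheory.EllipticCurves.ModularityVersionApProofs
import Literature.NumberTheory.EllipticCurves.ShuZhai2021.GeneralizedBirchLemma
import HarnessLib

/-!
# Route `CMKolyvaginAtInertTwo` (leaf `WAllCornerFTwo`): the MANIN binder of the habitat `H₂`
# on the slice "good at 2", BY NAME, modulo Abbes–Ullmo 1996 (cell `bsd-print-cf2`, seat ty2)

HONEST FRAMING. Nothing is asserted: no `def`, no named fact, no route file imported; the leaf
`Summit.BirchSwinnertonDyer.WAllCornerFTwo` is OPEN and this file proves bookkeeping only. The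
habitat `H₂` of `route-BirchSwinnertonDyer-CMKolyvaginAtInertTwo` (items
stmt-BirchSwinnertonDyer-22835/22836, residual 22838) carries the binder

  `∃ Dt : ModularParametrizationData W (W.conductorNorm ℤ),
      (∀ z ∈ Dt.L.lattice, ∃ w ∈ periodLattice Dt.f, z = (Dt.c : ℂ) * w) ∧ Odd Dt.c`

("`W` is (a globally minimal model of) the `X₀(N)`-optimal curve AND its Manin constant is odd" —
the printed hypothesis shape of Shu–Zhai 2021 Thm. 1.4 / Cai–Li–Zhai 2020,
`ShuZhai2021.IsOptimalDatum`, `CaiLiZhai2019.IsOptimalDatumWithOddManinConstant`). This file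
records that the SECOND clause is not an extra hypothesis on the slice `2 ∤ N` (good reduction at
`2`, e.g. every cube-sum curve `x³ + y³ = n` with `n` odd): by Abbes–Ullmo 1996 Thm. A (the tree's
named fact `abbesUllmo_not_dvd_maninConstant_of_not_dvd_level`, statement only, IN PRINT) an
optimal datum at a level prime to `2` has odd Manin constant. So on that slice the binder is
EXACTLY "`W` is optimal" (`maninBinder_iff_exists_isOptimalDatum_of_not_two_dvd_conductorNorm`),
and the Manin branch of the residual 22838 is empty there modulo `hAU`. On the complementary CM
slice `2 ∣ N` one has `4 ∣ N` (CM curves are additive at every bad prime), where NO printed theorem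
controls `ord₂` of the Manin constant (Česnavičius 2018 Thm. 1.2 needs `p² ∤ N`) — that part of the
binder stays a genuine hypothesis; nothing here speaks to it.

References: `Literature/NumberTheory/EllipticCurves/ManinConstantSemistablePrimewise.lean`
(the three children of Česnavičius 2018 Thm. 1.2 and their assembly
`cesnavicius2018_not_dvd_maninConstant_of_not_sq_dvd_level`);
`WeierstrassCurve.dvd_conductorNorm_iff_not_hasGoodReductionAtPrime` (`ModularityVersionApProofs`).
-/

namespace Summit.BirchSwinnertonDyer.Rank1Residual.P2

open Literature.NumberTheory.EllipticCurves.ModularForms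
open Literature.NumberTheory.EllipticCurves

variable (W : WeierstrassCurve ℚ) [W.IsElliptic] [W.IsGloballyMinimal]

/-! ## §1 Odd Manin constant of an optimal datum at a level prime to `2` -/

/-- **Abbes–Ullmo at `p = 2`.** For a globally minimal `W/ℚ`, a lattice-optimal `X₀(N)`-datum
`Dt` (`Λ_E ⊆ c·Λ_f`) at a level `N` with `2 ∤ N` has ODD Manin constant `c = Dt.c`, modulo the
named fact `hAU`. [cite: AbbesUllmo1996, Thm. A] -/
theorem odd_c_of_isOptimalDatum_of_not_two_dvd_level
    (hAU : abbesUllmo_not_dvd_maninConstant_of_not_dvd_level) {N : ℕ} [NeZero N]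
    (Dt : ModularParametrizationData W N)
    (hopt : ∀ z ∈ Dt.L.lattice, ∃ w ∈ periodLattice Dt.f, z = (Dt.c : ℂ) * w)
    (h2N : ¬ 2 ∣ N) : Odd Dt.c := by
  have h : ¬ (2 : ℤ) ∣ Dt.c := by exact_mod_cast hAU W Dt hopt 2 Nat.prime_two h2N
  rcases Int.even_or_odd Dt.c with he | ho
  · exact absurd (even_iff_two_dvd.mp he) h
  · exact ho

/-- The same at level `N = N_W` (the binder's level): `2 ∤ N_W` ⟹ every optimal datum of `W` has
odd Manin constant, modulo `hAU`. [cite: AbbesUllmo1996, Thm. A] -/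
theorem odd_c_of_isOptimalDatum_of_not_two_dvd_conductorNorm
    (hAU : abbesUllmo_not_dvd_maninConstant_of_not_dvd_level) [NeZero (W.conductorNorm ℤ)]
    (Dt : ModularParametrizationData W (W.conductorNorm ℤ))
    (hopt : ∀ z ∈ Dt.L.lattice, ∃ w ∈ periodLattice Dt.f, z = (Dt.c : ℂ) * w)
    (h2N : ¬ 2 ∣ W.conductorNorm ℤ) : Odd Dt.c :=
  odd_c_of_isOptimalDatum_of_not_two_dvd_level W hAU Dt hopt h2N

/-- The same keyed to GOOD REDUCTION AT `2` (`2 ∤ N_W ⟺ W good at 2`,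
`WeierstrassCurve.dvd_conductorNorm_iff_not_hasGoodReductionAtPrime`): for `W` good at `2`, every
optimal datum of `W` has odd Manin constant, modulo `hAU`. [cite: AbbesUllmo1996, Thm. A] -/
theorem odd_c_of_isOptimalDatum_of_hasGoodReductionAtPrime_two
    (hAU : abbesUllmo_not_dvd_maninConstant_of_not_dvd_level) [NeZero (W.conductorNorm ℤ)]
    (Dt : ModularParametrizationData W (W.conductorNorm ℤ))
    (hopt : ∀ z ∈ Dt.L.lattice, ∃ w ∈ periodLattice Dt.f, z = (Dt.c : ℂ) * w)
    (hgood : W.HasGoodReductionAtPrime 2) : Odd Dt.c :=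
  odd_c_of_isOptimalDatum_of_not_two_dvd_conductorNorm W hAU Dt hopt
    fun h => (W.dvd_conductorNorm_iff_not_hasGoodReductionAtPrime 2).mp h hgood

/-! ## §2 The habitat's Manin binder on the slice `2 ∤ N` -/

/-- **The `H₂` Manin binder on the good-at-2 slice is exactly "`W` is optimal".** For a globally
minimal `W/ℚ` with `2 ∤ N_W`, modulo `hAU`: the habitat binder
`∃ Dt, (Λ_E ⊆ c·Λ_f) ∧ Odd c` holds iff `W` admits a lattice-optimal `X₀(N_W)`-datum
(`ShuZhai2021.IsOptimalDatum`). [cite: AbbesUllmo1996, Thm. A]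
[cite: ShuZhai2021, §1 ("an optimal modular parametrization")] -/
theorem maninBinder_iff_exists_isOptimalDatum_of_not_two_dvd_conductorNorm
    (hAU : abbesUllmo_not_dvd_maninConstant_of_not_dvd_level) [NeZero (W.conductorNorm ℤ)]
    (h2N : ¬ 2 ∣ W.conductorNorm ℤ) :
    (∃ Dt : ModularParametrizationData W (W.conductorNorm ℤ),
      (∀ z ∈ Dt.L.lattice, ∃ w ∈ periodLattice Dt.f, z = (Dt.c : ℂ) * w) ∧ Odd Dt.c) ↔
    ∃ Dt : ModularParametrizationData W (W.conductorNorm ℤ), ShuZhai2021.IsOptimalDatum W Dt :=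
  ⟨fun ⟨Dt, hopt, _⟩ => ⟨Dt, hopt⟩, fun ⟨Dt, hopt⟩ =>
    ⟨Dt, hopt, odd_c_of_isOptimalDatum_of_not_two_dvd_conductorNorm W hAU Dt hopt h2N⟩⟩

/-- **The `H₂` Manin binder from optimality, good-at-2 form.** For a globally minimal `W/ℚ` good
at `2` which admits a lattice-optimal `X₀(N_W)`-datum, the habitat's Manin binder holds, modulo
`hAU`. [cite: AbbesUllmo1996, Thm. A] -/
theorem maninBinder_of_exists_isOptimalDatum_of_hasGoodReductionAtPrime_two
    (hAU : abbesUllmo_not_dvd_maninConstant_of_not_dvd_level) [NeZero (W.conductorNorm ℤ)]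
    (hgood : W.HasGoodReductionAtPrime 2)
    (hopt : ∃ Dt : ModularParametrizationData W (W.conductorNorm ℤ),
      ShuZhai2021.IsOptimalDatum W Dt) :
    ∃ Dt : ModularParametrizationData W (W.conductorNorm ℤ),
      (∀ z ∈ Dt.L.lattice, ∃ w ∈ periodLattice Dt.f, z = (Dt.c : ℂ) * w) ∧ Odd Dt.c :=
  (maninBinder_iff_exists_isOptimalDatum_of_not_two_dvd_conductorNorm W hAU
    fun h => (W.dvd_conductorNorm_iff_not_hasGoodReductionAtPrime 2).mp h hgood).mpr hopt

/-- **The Manin branch of the residual is empty on the good-at-2 slice.** For a globally minimal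
`W/ℚ` good at `2`, modulo `hAU`: if the habitat's Manin binder FAILS then `W` admits no
lattice-optimal `X₀(N_W)`-datum (i.e. `W` is not the optimal curve of its class) — the parity
clause never fails alone. [cite: AbbesUllmo1996, Thm. A] -/
theorem not_exists_isOptimalDatum_of_not_maninBinder_of_hasGoodReductionAtPrime_two
    (hAU : abbesUllmo_not_dvd_maninConstant_of_not_dvd_level) [NeZero (W.conductorNorm ℤ)]
    (hgood : W.HasGoodReductionAtPrime 2)
    (hno : ¬ ∃ Dt : ModularParametrizationData W (W.conductorNorm ℤ),
      (∀ z ∈ Dt.L.lattice, ∃ w ∈ periodLattice Dt.f, z = (Dt.c : ℂ) * w) ∧ Odd Dt.c)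
    (Dt : ModularParametrizationData W (W.conductorNorm ℤ)) :
    ¬ ShuZhai2021.IsOptimalDatum W Dt :=
  fun hopt => hno
    (maninBinder_of_exists_isOptimalDatum_of_hasGoodReductionAtPrime_two W hAU hgood ⟨Dt, hopt⟩)

end Summit.BirchSwinnertonDyer.Rank1Residual.P2
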